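import Literature.MathematicalPhysics.QuantumLattice.HubbardGaugeBoundSharp
import Literature.MathematicalPhysics.QuantumLattice.HubbardHubbardModelKomaTasakiProofs
import HarnessLib

/-!
# Koma–Tasaki's a priori bound with the printed hopping norm for SPIN-DEPENDENT sign gauges
# (magnetic and one-particle correlations)

Trunk T-QLATTICE (family `hubbard`; consumers: the Koma–Tasaki decay bounds of
`HubbardHubbardModelKomaTasakiProofs.lean` and the cell files
`Summits/HubbardSuperconductivity/HubbardLadder/Bounds/SpinCorrelationEtaLineEuclid.lean`).

Koma–Tasaki (PRL 68 (1992) 3248) prove their Theorem for the superconducting correlation with the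
charge gauge `θ_{uσ} = -iφ_u` (eq. (5)) and remark in the last paragraph of the proof that the
magnetic correlation `⟨S⁺_x S⁻_y⟩` is treated "in the same way" with the spin-dependent gauge
`θ_{u↑} = +iφ_u`, `θ_{u↓} = -iφ_u`. For such SIGN gauges `v_{uσ} = ε_σ ψ_u`, `ε_σ = ±1`, the
Hermitian part of the gauge-transformed hopping term is the SAME operator as for the charge gauge,
`U = -t Σ_{u∼v,σ} (cosh(ψ_u - ψ_v) - 1) c†_{uσ} c_{vσ}` (`cosh` is even), so the printed bound
`‖U‖ ≤ |t| Σ_u Σ_v [u ∼ v] (cosh(ψ_u - ψ_v) - 1)` of eq. (11) — ordered pairs, NO spin factor,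
"where we have used `‖c†_{xσ} c_{yσ} + c†_{yσ} c_{xσ}‖ = 1`" — applies verbatim
(`norm_hoppingPerturbation_le_sharp` of `HubbardGaugeBoundSharp.lean`). The tree's
`norm_gibbsState_hubbardTorusWith_le` / `norm_thermalCorr_siteSpinPlus_le`
(`HubbardHubbardModelKomaTasakiProofs.lean`) count `‖c†c‖ ≤ 1` per ordered pair AND per spin and
carry the cost `2β|t| Σ_u Σ_v [u∼v](cosh - 1)`, off by the factor `2` in the exponent. This file
supplies the printed constant for every sign gauge:

* `signWeights ε ψ` — the orbital weights `(u, σ) ↦ ε_σ ψ_u`;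
* `gauge_hermitianPart_sub_hamiltonianWith_signWeights` — the Hermitian part of
  `G_{e^v}(H - μN)G_{e^v}⁻¹` minus `H - μN` is `-t · hoppingForm G (cosh(ψ_u - ψ_v) - 1)`;
* `norm_gauge_hermitianPart_sub_hamiltonianWith_signWeights_le` — its norm is
  `≤ |t| Σ_u Σ_v [u ∼ v] (cosh(ψ_u - ψ_v) - 1)` (eq. (11) as printed);
* `norm_trace_mul_gibbsWeight_hamiltonianWith_le_signWeights` — the trace bound (eqs. (6), (10),
  (11)) for every gauge eigen-operator `A`, any finite hopping graph;
* `norm_gibbsState_hubbardTorusWith_le_signWeights` — the torus Gibbs-state form with `‖A‖ ≤ 1`;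
* `norm_thermalCorr_siteSpinPlus_le_sharp` — the magnetic a priori bound
  `|⟨S⁺_x S⁻_y⟩_{β,L}| ≤ e^{-2(ψ_x - ψ_y)} exp[β|t| Σ_u Σ_v [u∼v](cosh(ψ_u - ψ_v) - 1)]`;
* `norm_thermalCorr_creation_annihilation_le_sharp` — the one-particle a priori bound
  `|⟨c†_{xσ} c_{yσ}⟩_{β,L}| ≤ e^{-(ψ_x - ψ_y)} exp[β|t| Σ_u Σ_v [u∼v](cosh(ψ_u - ψ_v) - 1)]`
  (charge gauge, gauge charge `1`).

Sources: T. Koma, H. Tasaki, PRL 68 (1992) 3248 (= arXiv:cond-mat/9709068), eqs. (5)–(12) and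
the last paragraph of the proof; O. A. McBryan, T. Spencer, Commun. Math. Phys. 53 (1977) 299.

## Mathlib search

Mathlib has no fermionic Fock space; the concrete matrix model of the prelude is reused
(`creation`, `annihilation`, `orb`, `hoppingForm`, `hamiltonianWith`, the diagonal gauge weights
`diagonal (s ↦ ∏_{i∈s} e^{v_i})` of `HubbardHubbardModelKomaTasakiProofs` with
`gauge_hermitianPart_sub_hamiltonianWith`, `gauge_conj_creation_mul_annihilation`,
`gauge_conj_mul`, `koma_tasaki_trace_bound`, `norm_gibbsState_le_of_trace_bound`).

## Design notes

No statement of the prelude is changed; the sharp lemmas are stated next to the existing ones with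
the suffix `_signWeights` / `_sharp`. The proofs of the trace and Gibbs-state bounds are those of
`HubbardHubbardModelKomaTasakiProofs` with `norm_gauge_hermitianPart_sub_hamiltonianWith_le`
replaced by the sign-gauge bound.
-/

noncomputable section

namespace Literature.MathematicalPhysics.QuantumLattice

open Matrix Finset NormedSpace
open scoped Matrix.Norms.L2Operator ComplexOrder

/-! ### Sign gauges on a finite hopping graph -/

section SignGauge

variable {Λ : Type*} [LinearOrder Λ] [Fintype Λ] (G : SimpleGraph Λ) [DecidableRel G.Adj]

/-- The orbital weights of a SIGN gauge: `v_{(u,σ)} = ε_σ ψ_u` for a sign pattern `ε : Fin 2 → ℝ`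
(`ε ≡ -1`: Koma–Tasaki's charge gauge of eq. (5); `ε = (-1, +1)`: the spin-dependent gauge of the
magnetic case) and a real site function `ψ`. Koma–Tasaki, PRL 68 (1992) 3248, eq. (5) and the
last paragraph of the proof. [folklore] -/
def signWeights (ε : Fin 2 → ℝ) (ψ : Λ → ℝ) : Orb Λ → ℝ :=
  fun i => ε (ofLex i).2 * ψ (ofLex i).1

omit [LinearOrder Λ] [Fintype Λ] in
/-- `signWeights ε ψ (u, σ) = ε_σ ψ_u`. [folklore] -/
private theorem signWeights_orb (ε : Fin 2 → ℝ) (ψ : Λ → ℝ) (x : Λ) (σ : Fin 2) :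
    signWeights ε ψ (orb x σ) = ε σ * ψ x := by
  simp [signWeights, orb]

omit [LinearOrder Λ] [Fintype Λ] in
/-- For a sign pattern `ε_σ = ±1`, `cosh(v_{xσ} - v_{yσ}) = cosh(ψ_x - ψ_y)` (`cosh` is even).
Koma–Tasaki, PRL 68 (1992) 3248, last paragraph of the proof. [folklore] -/
private theorem cosh_signWeights_orb_sub (ε : Fin 2 → ℝ) (hε : ∀ σ, ε σ = 1 ∨ ε σ = -1) (ψ : Λ → ℝ)
    (x y : Λ) (σ : Fin 2) :
    Real.cosh (signWeights ε ψ (orb x σ) - signWeights ε ψ (orb y σ)) =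
      Real.cosh (ψ x - ψ y) := by
  rw [signWeights_orb, signWeights_orb]
  rcases hε σ with h | h
  · rw [h, one_mul, one_mul]
  · rw [h, ← Real.cosh_neg]; ring_nf

/-- **The Hermitian part of the sign-gauge-transformed Hamiltonian** (Koma–Tasaki eqs. (7), (9)
for `θ_{uσ} = -iε_σψ_u`): `(H' + H'ᴴ)/2 - (H - μN) = -t · T(cosh(ψ_u - ψ_v) - 1)` — the same
operator for every sign pattern. Koma–Tasaki, PRL 68 (1992) 3248, eqs. (7), (9) and the last
paragraph of the proof. [cite: KomaTasakiPRL1992, eqs. (7) and (9)] -/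
theorem gauge_hermitianPart_sub_hamiltonianWith_signWeights (ε : Fin 2 → ℝ)
    (hε : ∀ σ, ε σ = 1 ∨ ε σ = -1) (ψ : Λ → ℝ) (t U μ : ℝ) :
    (2 : ℂ)⁻¹ • ((diagonal (fun s : Finset (Orb Λ) =>
        ∏ i ∈ s, (Real.exp (signWeights ε ψ i) : ℂ)) * hamiltonianWith G t U μ *
        diagonal (fun s : Finset (Orb Λ) => ∏ i ∈ s, (Real.exp (-signWeights ε ψ i) : ℂ))) +
      (diagonal (fun s : Finset (Orb Λ) =>
        ∏ i ∈ s, (Real.exp (signWeights ε ψ i) : ℂ)) * hamiltonianWith G t U μ *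
        diagonal (fun s : Finset (Orb Λ) => ∏ i ∈ s, (Real.exp (-signWeights ε ψ i) : ℂ)))ᴴ) -
      hamiltonianWith G t U μ =
    -(t : ℂ) • hoppingForm G (fun u v => Real.cosh (ψ u - ψ v) - 1) := by
  rw [gauge_hermitianPart_sub_hamiltonianWith G (signWeights ε ψ) t U μ, hoppingForm_eq]
  congr 1
  refine sum_congr rfl fun x _ => sum_congr rfl fun y _ => sum_congr rfl fun σ _ => ?_
  rw [cosh_signWeights_orb_sub ε hε ψ x y σ]

/-- **Koma–Tasaki's eq. (11) as printed, for every sign gauge**: the Hermitian part `U` of the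
gauge-transformed Hamiltonian minus `H - μN` obeys
`‖U‖ ≤ |t| Σ_u Σ_v [u ∼ v] (cosh(ψ_u - ψ_v) - 1)` (ordered pairs, no spin factor;
`‖c†_{uσ}c_{vσ} + c†_{vσ}c_{uσ}‖ ≤ 1`). Koma–Tasaki, PRL 68 (1992) 3248, eq. (11), first
inequality. [cite: KomaTasakiPRL1992, eq. (11), first inequality] -/
theorem norm_gauge_hermitianPart_sub_hamiltonianWith_signWeights_le (ε : Fin 2 → ℝ)
    (hε : ∀ σ, ε σ = 1 ∨ ε σ = -1) (ψ : Λ → ℝ) (t U μ : ℝ) :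
    ‖(2 : ℂ)⁻¹ • ((diagonal (fun s : Finset (Orb Λ) =>
        ∏ i ∈ s, (Real.exp (signWeights ε ψ i) : ℂ)) * hamiltonianWith G t U μ *
        diagonal (fun s : Finset (Orb Λ) => ∏ i ∈ s, (Real.exp (-signWeights ε ψ i) : ℂ))) +
      (diagonal (fun s : Finset (Orb Λ) =>
        ∏ i ∈ s, (Real.exp (signWeights ε ψ i) : ℂ)) * hamiltonianWith G t U μ *
        diagonal (fun s : Finset (Orb Λ) => ∏ i ∈ s, (Real.exp (-signWeights ε ψ i) : ℂ)))ᴴ) -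
      hamiltonianWith G t U μ‖ ≤
    |t| * ∑ u : Λ, ∑ v : Λ, if G.Adj u v then (Real.cosh (ψ u - ψ v) - 1) else 0 := by
  rw [gauge_hermitianPart_sub_hamiltonianWith_signWeights G ε hε ψ t U μ]
  exact norm_hoppingPerturbation_le_sharp G ψ t

/-- **Koma–Tasaki bound for the Hubbard Gibbs weight, sign gauge, printed constant** (fermionic
form of eqs. (6), (10), (11)): for any finite graph, a sign gauge `v = ε ⊗ ψ`, `β ≥ 0`, and an
observable `A` with `G_{e^v} A G_{e^v}⁻¹ = κ A`,
`|Tr (A e^{-β(H - μN)})| ≤ |κ| ‖A‖ exp [β |t| Σ_u Σ_v [u∼v] (cosh (ψ_u - ψ_v) - 1)] Tr e^{-β(H - μN)}`.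
Koma–Tasaki, PRL 68 (1992) 3248, eqs. (6), (10), (11). [cite: KomaTasakiPRL1992, eqs. (6)–(11)] -/
theorem norm_trace_mul_gibbsWeight_hamiltonianWith_le_signWeights (ε : Fin 2 → ℝ)
    (hε : ∀ σ, ε σ = 1 ∨ ε σ = -1) (ψ : Λ → ℝ) (t U μ β : ℝ) (hβ : 0 ≤ β)
    (A : Matrix (Finset (Orb Λ)) (Finset (Orb Λ)) ℂ) (κ : ℂ)
    (hA : diagonal (fun s : Finset (Orb Λ) => ∏ i ∈ s, (Real.exp (signWeights ε ψ i) : ℂ)) *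
        A * diagonal (fun s : Finset (Orb Λ) =>
          ∏ i ∈ s, (Real.exp (-signWeights ε ψ i) : ℂ)) = κ • A) :
    ‖(A * exp (-(β : ℂ) • hamiltonianWith G t U μ)).trace‖ ≤
      ‖κ‖ * ‖A‖ * Real.exp (β * (|t| * ∑ u : Λ, ∑ v : Λ, if G.Adj u v then
        (Real.cosh (ψ u - ψ v) - 1) else 0)) *
        ((exp (-(β : ℂ) • hamiltonianWith G t U μ)).trace).re := by
  set v : Orb Λ → ℝ := signWeights ε ψ with hv
  set W : Matrix (Finset (Orb Λ)) (Finset (Orb Λ)) ℂ :=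
    diagonal (fun s : Finset (Orb Λ) => ∏ i ∈ s, (Real.exp (v i) : ℂ)) with hW
  set W' : Matrix (Finset (Orb Λ)) (Finset (Orb Λ)) ℂ :=
    diagonal (fun s : Finset (Orb Λ) => ∏ i ∈ s, (Real.exp (-v i) : ℂ)) with hW'
  have h1 : W * W' = 1 := diagonal_prod_exp_mul_diagonal_prod_exp_neg v
  have h2 : W' * W = 1 := diagonal_prod_exp_neg_mul_diagonal_prod_exp v
  let Gu : (Matrix (Finset (Orb Λ)) (Finset (Orb Λ)) ℂ)ˣ := ⟨W, W', h1, h2⟩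
  set H : Matrix (Finset (Orb Λ)) (Finset (Orb Λ)) ℂ := hamiltonianWith G t U μ with hH
  have hHh : H.IsHermitian := isHermitian_hamiltonianWith G t U μ
  have hβH : ((β : ℂ) • H).IsHermitian := isHermitian_real_smul hHh β
  have key := koma_tasaki_trace_bound hβH Gu A κ hA
  have hneg : -((β : ℂ) • H) = -(β : ℂ) • H := (neg_smul _ _).symm
  rw [hneg] at key
  refine key.trans ?_
  have hUn : ‖(2 : ℂ)⁻¹ • ((Gu : Matrix _ _ ℂ) * ((β : ℂ) • H) *
      ((Gu⁻¹ : (Matrix _ _ ℂ)ˣ) : Matrix _ _ ℂ) +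
      ((Gu : Matrix _ _ ℂ) * ((β : ℂ) • H) * ((Gu⁻¹ : (Matrix _ _ ℂ)ˣ) : Matrix _ _ ℂ))ᴴ) -
        (β : ℂ) • H‖ ≤
      β * (|t| * ∑ u : Λ, ∑ v : Λ, if G.Adj u v then
        (Real.cosh (ψ u - ψ v) - 1) else 0) := by
    have hGu : (Gu : Matrix _ _ ℂ) = W := rfl
    have hGu' : ((Gu⁻¹ : (Matrix _ _ ℂ)ˣ) : Matrix _ _ ℂ) = W' := rfl
    rw [hGu, hGu']
    have hs : star (β : ℂ) = β := by simp
    have hcalc : (2 : ℂ)⁻¹ • (W * ((β : ℂ) • H) * W' + (W * ((β : ℂ) • H) * W')ᴴ) - (β : ℂ) • H =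
        (β : ℂ) • ((2 : ℂ)⁻¹ • (W * H * W' + (W * H * W')ᴴ) - H) := by
      rw [Matrix.mul_smul, Matrix.smul_mul, conjTranspose_smul, hs, ← smul_add, smul_comm,
        ← smul_sub]
    rw [hcalc, norm_smul, Complex.norm_real, Real.norm_eq_abs, abs_of_nonneg hβ]
    exact mul_le_mul_of_nonneg_left
      (norm_gauge_hermitianPart_sub_hamiltonianWith_signWeights_le G ε hε ψ t U μ) hβ
  have htr : 0 ≤ ((exp (-(β : ℂ) • H)).trace).re := by
    rw [← hneg, Complex.re_eq_norm.mpr (posSemidef_exp_of_isHermitian hβH.neg).trace_nonneg]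
    exact norm_nonneg _
  gcongr

end SignGauge

/-! ### The torus: Gibbs state, magnetic and one-particle correlations -/

section Torus

open Literature.Probability.LatticeModels

variable {d L : ℕ} [NeZero L]

/-- The bond sum of a site function lifted to the fermionic torus equals the bond sum on
`(ℤ/Lℤ)^d` (the fermionic torus graph is the comap of `torusGraph`). [folklore] -/
private theorem sum_sum_fermionTorusGraph_cosh_eq (ψ : TorusSite d L → ℝ) :
    (∑ u : FermionTorus d L, ∑ v : FermionTorus d L,
      if (fermionTorusGraph d L).Adj u v then
        (Real.cosh (ψ (FermionTorus.toTorusSite u) - ψ (FermionTorus.toTorusSite v)) - 1)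
      else 0) =
      ∑ a : TorusSite d L, ∑ b : TorusSite d L,
        if (torusGraph d L).Adj a b then (Real.cosh (ψ a - ψ b) - 1) else 0 := by
  refine Fintype.sum_equiv FermionTorus.equivTorusSite _ _ fun u => ?_
  refine Fintype.sum_equiv FermionTorus.equivTorusSite _ _ fun v => ?_
  simp [FermionTorus.equivTorusSite]

/-- **Koma–Tasaki bound for the torus Hubbard Gibbs state of a sign-gauge eigen-operator, printed
constant**: for a sign pattern `ε_σ = ±1`, a real `ψ` on `(ℤ/Lℤ)^d`, weights
`v_{(u,σ)} = ε_σ ψ_u`, `β ≥ 0`, and `A` with `‖A‖ ≤ 1`, `G_{e^v} A G_{e^v}⁻¹ = κ A`: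
`|⟨A⟩_{β,L}| ≤ |κ| exp [β |t| Σ_u Σ_{u'} [u ∼ u'] (cosh (ψ_u - ψ_{u'}) - 1)]` — half the exponent
of `norm_gibbsState_hubbardTorusWith_le`. Stated for an arbitrary `[DecidableEq (FermionTorus d L)]`
instance. Koma–Tasaki, PRL 68 (1992) 3248, eqs. (6)–(12). [cite: KomaTasakiPRL1992, eqs. (6)–(12)] -/
theorem norm_gibbsState_hubbardTorusWith_le_signWeights [instDE : DecidableEq (FermionTorus d L)]
    (t U μ β : ℝ) (hβ : 0 ≤ β) (ε : Fin 2 → ℝ) (hε : ∀ σ, ε σ = 1 ∨ ε σ = -1)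
    (ψ : TorusSite d L → ℝ)
    (A : Matrix (Finset (Orb (FermionTorus d L))) (Finset (Orb (FermionTorus d L))) ℂ) (κ : ℂ)
    (hA : diagonal (fun s : Finset (Orb (FermionTorus d L)) => ∏ i ∈ s,
          (Real.exp (signWeights ε (fun u => ψ (FermionTorus.toTorusSite u)) i) : ℂ)) * A *
        diagonal (fun s : Finset (Orb (FermionTorus d L)) => ∏ i ∈ s,
          (Real.exp (-signWeights ε (fun u => ψ (FermionTorus.toTorusSite u)) i) : ℂ)) =
        κ • A)
    (hAn : ‖A‖ ≤ 1) :
    ‖gibbsState β (hubbardTorusWith d L t U μ) A‖ ≤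
      ‖κ‖ * Real.exp (β * (|t| * ∑ u, ∑ u',
        (if (torusGraph d L).Adj u u' then Real.cosh (ψ u - ψ u') - 1 else 0))) := by
  obtain rfl : instDE = LinearOrder.toDecidableEq := Subsingleton.elim _ _
  letI instDE : DecidableEq (FermionTorus d L) := LinearOrder.toDecidableEq
  have key := norm_trace_mul_gibbsWeight_hamiltonianWith_le_signWeights (fermionTorusGraph d L)
    ε hε (fun u => ψ (FermionTorus.toTorusSite u)) t U μ β hβ A κ hA
  rw [sum_sum_fermionTorusGraph_cosh_eq ψ] at key
  have hH : (hubbardTorusWith d L t U μ).IsHermitian := isHermitian_hamiltonianWith _ t U μ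
  refine norm_gibbsState_le_of_trace_bound hH β A (key.trans ?_)
  have htr : 0 ≤ ((exp (-(β : ℂ) • hamiltonianWith (fermionTorusGraph d L) t U μ)).trace).re := by
    have hβH : (-(β : ℂ) • hamiltonianWith (fermionTorusGraph d L) t U μ).IsHermitian := by
      have := isHermitian_real_smul (isHermitian_hamiltonianWith (fermionTorusGraph d L) t U μ) (-β)
      simpa using this
    rw [Complex.re_eq_norm.mpr (posSemidef_exp_of_isHermitian hβH).trace_nonneg]
    exact norm_nonneg _
  calc _ ≤ ‖κ‖ * 1 * Real.exp (β * (|t| * ∑ u, ∑ u',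
        (if (torusGraph d L).Adj u u' then Real.cosh (ψ u - ψ u') - 1 else 0))) *
        ((exp (-(β : ℂ) • hamiltonianWith (fermionTorusGraph d L) t U μ)).trace).re := by
        gcongr
    _ = _ := by rw [mul_one]; rfl

/-- **Koma–Tasaki's a priori bound for the transverse spin correlation, printed constant** (the
finite-volume eq. (12) of the magnetic case before the choice of `φ`): for every real `ψ` on
`(ℤ/Lℤ)^d`, `β ≥ 0` and all `t, U, μ`,
`|⟨S⁺_x S⁻_y⟩_{β,L}| ≤ e^{-2(ψ_x - ψ_y)} exp [β |t| Σ_u Σ_{u'} [u ∼ u'] (cosh (ψ_u - ψ_{u'}) - 1)]`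
(spin gauge `v_{(u,↑)} = -ψ_u`, `v_{(u,↓)} = +ψ_u`; eigenvalue `e^{-2(ψ_x - ψ_y)}`) —
`norm_thermalCorr_siteSpinPlus_le` with the factor `2` of the exponent removed.
Koma–Tasaki, PRL 68 (1992) 3248, eqs. (6)–(12) and the last paragraph of the proof.
[cite: KomaTasakiPRL1992, eq. (12), magnetic case] -/
theorem norm_thermalCorr_siteSpinPlus_le_sharp [instDE : DecidableEq (FermionTorus d L)]
    (t U μ β : ℝ) (hβ : 0 ≤ β) (ψ : TorusSite d L → ℝ) (x y : TorusSite d L) :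
    ‖(hubbardTorusWith d L t U μ).thermalCorr β (siteSpinPlus x) (siteSpinPlus y)ᴴ‖ ≤
      Real.exp (-(2 * (ψ x - ψ y))) * Real.exp (β * (|t| *
        ∑ u, ∑ u', (if (torusGraph d L).Adj u u' then Real.cosh (ψ u - ψ u') - 1 else 0))) := by
  obtain rfl : instDE = LinearOrder.toDecidableEq := Subsingleton.elim _ _
  letI instDE : DecidableEq (FermionTorus d L) := LinearOrder.toDecidableEq
  -- the spin-dependent sign pattern `ε = (-1, +1)`
  let ε : Fin 2 → ℝ := fun σ => if σ = 0 then -1 else 1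
  have hε : ∀ σ, ε σ = 1 ∨ ε σ = -1 := fun σ => by
    simp only [ε]; split_ifs <;> simp
  set v : Orb (FermionTorus d L) → ℝ :=
    signWeights ε (fun u => ψ (FermionTorus.toTorusSite u)) with hvdef
  have hv0 : ∀ z : FermionTorus d L, v (orb z 0) = -ψ (FermionTorus.toTorusSite z) := by
    intro z; rw [hvdef, signWeights_orb]; simp [ε]
  have hv1 : ∀ z : FermionTorus d L, v (orb z 1) = ψ (FermionTorus.toTorusSite z) := by
    intro z; rw [hvdef, signWeights_orb]; simp [ε]
  let X := FermionTorus.ofTorusSite x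
  let Y := FermionTorus.ofTorusSite y
  let P : Matrix (Finset (Orb (FermionTorus d L))) (Finset (Orb (FermionTorus d L))) ℂ :=
    creation (orb X 0) * annihilation (orb X 1)
  let Q : Matrix (Finset (Orb (FermionTorus d L))) (Finset (Orb (FermionTorus d L))) ℂ :=
    creation (orb Y 1) * annihilation (orb Y 0)
  have hAeq : siteSpinPlus x * (siteSpinPlus y)ᴴ = P * Q := siteSpinPlus_mul_conjTranspose x y
  have hWA := gauge_conj_mul v (gauge_conj_creation_mul_annihilation v (orb X 0) (orb X 1))
    (gauge_conj_creation_mul_annihilation v (orb Y 1) (orb Y 0))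
  have hκn : ‖(Real.exp (v (orb X 0) - v (orb X 1)) : ℂ) *
      (Real.exp (v (orb Y 1) - v (orb Y 0)) : ℂ)‖ = Real.exp (-(2 * (ψ x - ψ y))) := by
    rw [norm_mul, Complex.norm_real, Complex.norm_real, Real.norm_eq_abs, Real.norm_eq_abs,
      abs_of_pos (Real.exp_pos _), abs_of_pos (Real.exp_pos _), ← Real.exp_add, hv0, hv1, hv0, hv1]
    simp only [X, Y, FermionTorus.toTorusSite_ofTorusSite]
    ring_nf
  have hAn : ‖P * Q‖ ≤ 1 := by
    calc ‖P * Q‖ ≤ ‖P‖ * ‖Q‖ := l2_opNorm_mul _ _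
      _ ≤ 1 * 1 := mul_le_mul (l2_opNorm_creation_mul_annihilation_le_one _ _)
          (l2_opNorm_creation_mul_annihilation_le_one _ _) (norm_nonneg _) zero_le_one
      _ = 1 := one_mul 1
  have core := norm_gibbsState_hubbardTorusWith_le_signWeights t U μ β hβ ε hε ψ (P * Q) _
    hWA hAn
  rw [hκn] at core
  rw [Matrix.thermalCorr, hAeq]
  exact core

/-- **Koma–Tasaki's a priori bound for the one-particle Green's function, printed constant**: for
every real `ψ` on `(ℤ/Lℤ)^d`, `β ≥ 0`, all `t, U, μ`, sites `x, y` and a spin `σ`,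
`|⟨c†_{xσ} c_{yσ}⟩_{β,L}| ≤ e^{-(ψ_x - ψ_y)} exp [β |t| Σ_u Σ_{u'} [u ∼ u'] (cosh (ψ_u - ψ_{u'}) - 1)]`
(charge gauge `v_{(u,σ)} = -ψ_u` of eq. (5); the observable has gauge charge `1`, eigenvalue
`e^{-(ψ_x - ψ_y)}` by eq. (8)). Koma–Tasaki, PRL 68 (1992) 3248, eqs. (5)–(12) (the method
"applies to other correlation functions"). [cite: KomaTasakiPRL1992, eqs. (8) and (12)] -/
theorem norm_thermalCorr_creation_annihilation_le_sharp [instDE : DecidableEq (FermionTorus d L)]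
    (t U μ β : ℝ) (hβ : 0 ≤ β) (ψ : TorusSite d L → ℝ) (x y : TorusSite d L) (σ : Fin 2) :
    ‖(hubbardTorusWith d L t U μ).thermalCorr β
        (creation (orb (FermionTorus.ofTorusSite x) σ))
        (annihilation (orb (FermionTorus.ofTorusSite y) σ))‖ ≤
      Real.exp (-(ψ x - ψ y)) * Real.exp (β * (|t| *
        ∑ u, ∑ u', (if (torusGraph d L).Adj u u' then Real.cosh (ψ u - ψ u') - 1 else 0))) := by
  obtain rfl : instDE = LinearOrder.toDecidableEq := Subsingleton.elim _ _
  letI instDE : DecidableEq (FermionTorus d L) := LinearOrder.toDecidableEq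
  -- the charge gauge, sign pattern `ε ≡ -1`
  let ε : Fin 2 → ℝ := fun _ => -1
  have hε : ∀ σ, ε σ = 1 ∨ ε σ = -1 := fun σ => Or.inr rfl
  set v : Orb (FermionTorus d L) → ℝ :=
    signWeights ε (fun u => ψ (FermionTorus.toTorusSite u)) with hvdef
  have hv : ∀ (z : FermionTorus d L) (τ : Fin 2),
      v (orb z τ) = -ψ (FermionTorus.toTorusSite z) := by
    intro z τ; rw [hvdef, signWeights_orb]; simp [ε]
  let X := FermionTorus.ofTorusSite x
  let Y := FermionTorus.ofTorusSite y
  let P : Matrix (Finset (Orb (FermionTorus d L))) (Finset (Orb (FermionTorus d L))) ℂ :=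
    creation (orb X σ) * annihilation (orb Y σ)
  have hWA := gauge_conj_creation_mul_annihilation v (orb X σ) (orb Y σ)
  have hκn : ‖(Real.exp (v (orb X σ) - v (orb Y σ)) : ℂ)‖ = Real.exp (-(ψ x - ψ y)) := by
    rw [Complex.norm_real, Real.norm_eq_abs, abs_of_pos (Real.exp_pos _), hv, hv]
    simp only [X, Y, FermionTorus.toTorusSite_ofTorusSite]
    ring_nf
  have hAn : ‖P‖ ≤ 1 := l2_opNorm_creation_mul_annihilation_le_one _ _
  have core := norm_gibbsState_hubbardTorusWith_le_signWeights t U μ β hβ ε hε ψ P _ hWA hAn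
  rw [hκn] at core
  rw [Matrix.thermalCorr]
  exact core

end Torus

end Literature.MathematicalPhysics.QuantumLattice

end
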